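import Mathlib.NumberTheory.ZetaValues
import Literature.NumberTheory.LFunctions.ZeroStatistics
import HarnessLib

/-!
# Rudnick–Sarnak `n`-level correlations: local bookkeeping lemmas (proved)

Companion of `ZeroStatistics.lean` / `RHConditionalFacts.lean` (named fact
`Literature.NumberTheory.LFunctions.rudnick_sarnak`, Rudnick–Sarnak, *Duke Math. J.* **81**
(1996), Thm. 1.2 for `ζ`). Proofs only: no definitions, no named facts, nothing about `ζ`.

Rudnick–Sarnak establish the GUE limit of the `n`-level correlation sums
`R_n(f, T) = (1/N(T)) ∑*_{i_1,…,i_n ≤ N(T)} f(γ̃_{i_1}, …, γ̃_{i_n})` along the *heights* `T → ∞`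
(their (3.1), (4.5), (4.15)); the printed Theorem 1.2 is the limit of `R_n(B_N, f)` along *all*
`N → ∞`. When `N(T)` jumps by more than one (a multiple zero, or several zeros with the same
ordinate) the intermediate `B_N` are not of the form `B_{N(T)}`, and one needs the (easy, but not
printed) estimate `|R_n(B_N, f) − R_n(B_{N'}, f)| ≪ (N' − N) (log T)^{n} / N'` for
`N ≤ N' = N(T)`, from the decay of `f` and the local density `≪ log T` of normalised ordinates.
This file proves the *generic* half of that estimate, for an arbitrary sequence `p : ℕ → ℝ` in
place of the normalised ordinates and an arbitrary `F` obeying the Schwartz-type "pivot bound"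
`‖F x‖ ≤ C ∏_a (1 + |x_a − x_i|)^{-2}`:

* `IsRSTestFunction.exists_norm_le_prod`: a Rudnick–Sarnak test function (TF1–TF3 of
  `ZeroStatistics.lean`) obeys the pivot bound for every pivot `i`.
* `RudnickSarnak.sum_inv_one_add_abs_sub_sq_le`: if every window `[y, y+1]` contains at most `M`
  of the points `p_c`, `c ∈ s`, then `∑_{c ∈ s} (1 + |p_c − x|)^{-2} ≤ 6M` for every `x`.
* `RudnickSarnak.levelCorrelationSum_eq_sum_filter`: `levelCorrelationSum n f N` as a sum over
  injective tuples `u : Fin n → ℕ` with values `< N`.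
* `RudnickSarnak.norm_tupleSum_sdiff_le`, `RudnickSarnak.norm_tupleSum_le`: the tuple-sum estimates
  `‖S(N') − S(N)‖ ≤ n C (N' − N) sⁿ` and `‖S(N)‖ ≤ C N sⁿ`, where `s ≥ 1` bounds the local sums
  `∑_{c < N'} (1 + |p_c − p_b|)^{-2}`.

The `ζ`-specific half (local density of the `γ̃` from the Riemann–von Mangoldt formula) and the
assembly are in `RudnickSarnakZeros.lean` and `RudnickSarnak.lean`.

## References

* Z. Rudnick, P. Sarnak, *Zeros of principal `L`-functions and random matrix theory*, Duke
  Math. J. 81 (1996), 269–322: (1.3), (3.1), Thm. 1.2, §4 (4.5), (4.15).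
-/

noncomputable section

open Finset

namespace Literature.NumberTheory.LFunctions

/-! ## The pivot bound for Rudnick–Sarnak test functions -/

/-- A Rudnick–Sarnak test function `f` on `ℝ^{k+1}` (TF1 diagonal invariance, TF2 symmetry, TF3
Schwartz slice; Rudnick–Sarnak 1996 §1) satisfies, for some `C ≥ 0`, the bound
`‖f(x)‖ ≤ C ∏_a (1 + |x_a − x_i|)^{-2}` for every point `x` and every pivot coordinate `i`:
by TF1 `f(x) = f(0, x_1 − x_0, …)` is the Schwartz slice at `y_l = x_{l+1} − x_0`, whose decay
`(1 + ‖y‖)^{2k} ‖g(y)‖ ≤ D` gives the product bound with pivot `0` (`|y_l| ≤ ‖y‖`), and TF2 moves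
the pivot. [cite: RudnickSarnak1996, §1 TF1–TF3] -/
theorem IsRSTestFunction.exists_norm_le_prod {k : ℕ} {f : (Fin (k + 1) → ℝ) → ℂ}
    (hf : IsRSTestFunction k f) :
    ∃ C : ℝ, 0 ≤ C ∧ ∀ (x : Fin (k + 1) → ℝ) (i : Fin (k + 1)),
      ‖f x‖ ≤ C * ∏ a, ((1 + |x a - x i|) ^ 2)⁻¹ := by
  obtain ⟨g, hg⟩ := hf.schwartz_slice
  -- Schwartz decay of the slice with weight `(1 + ‖y‖) ^ (2 * k)`.
  set D : ℝ := 2 ^ (2 * k) *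
    (Finset.Iic (2 * k, 0)).sup (fun m ↦ SchwartzMap.seminorm ℝ m.1 m.2) g with hD
  have hD0 : 0 ≤ D := by positivity
  have hdecay : ∀ y : Fin k → ℝ, (1 + ‖y‖) ^ (2 * k) * ‖g y‖ ≤ D := fun y ↦ by
    have h := SchwartzMap.one_add_le_sup_seminorm_apply (𝕜 := ℝ) (m := (2 * k, 0))
      (k := 2 * k) (n := 0) le_rfl le_rfl g y
    rwa [norm_iteratedFDeriv_zero] at h
  -- Pivot `0`.
  have hpiv0 : ∀ x : Fin (k + 1) → ℝ, ‖f x‖ ≤ D * ∏ a, ((1 + |x a - x 0|) ^ 2)⁻¹ := by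
    intro x
    set y : Fin k → ℝ := fun l ↦ x l.succ - x 0 with hy
    have hfx : f x = g y := by
      have h1 : f x = f (fun a ↦ x a + -x 0) := (hf.diag_invariant x (-x 0)).symm
      have h2 : (fun a ↦ x a + -x 0) = Fin.cons 0 y := by
        funext a
        refine Fin.cases ?_ (fun l ↦ ?_) a
        · simp
        · simp [hy, sub_eq_add_neg]
      rw [h1, h2, hg]
      rfl
    have hyl : ∀ l : Fin k, ((1 + ‖y‖) ^ 2)⁻¹ ≤ ((1 + |y l|) ^ 2)⁻¹ := fun l ↦ by
      have : |y l| ≤ ‖y‖ := by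
        rw [← Real.norm_eq_abs]
        exact norm_le_pi_norm y l
      gcongr
    have hprod : ((1 + ‖y‖) ^ (2 * k))⁻¹ ≤ ∏ l : Fin k, ((1 + |y l|) ^ 2)⁻¹ := by
      calc ((1 + ‖y‖) ^ (2 * k))⁻¹ = ∏ _l : Fin k, ((1 + ‖y‖) ^ 2)⁻¹ := by
            rw [Fin.prod_const, pow_mul, inv_pow]
        _ ≤ ∏ l : Fin k, ((1 + |y l|) ^ 2)⁻¹ :=
            Finset.prod_le_prod (fun l _ ↦ by positivity) fun l _ ↦ hyl l
    have hpos : 0 < (1 + ‖y‖) ^ (2 * k) := by positivity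
    have hgy : ‖g y‖ ≤ D * ((1 + ‖y‖) ^ (2 * k))⁻¹ := by
      rw [← div_eq_mul_inv, le_div_iff₀ hpos, mul_comm]
      exact hdecay y
    have hsucc : ∏ a : Fin (k + 1), ((1 + |x a - x 0|) ^ 2)⁻¹ =
        ∏ l : Fin k, ((1 + |y l|) ^ 2)⁻¹ := by
      rw [Fin.prod_univ_succ]
      simp [hy]
    rw [hfx, hsucc]
    exact hgy.trans (mul_le_mul_of_nonneg_left hprod hD0)
  -- General pivot by symmetry.
  refine ⟨D, hD0, fun x i ↦ ?_⟩
  have hswap : f (x ∘ Equiv.swap 0 i) = f x := hf.symmetric (Equiv.swap 0 i) x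
  have h := hpiv0 (x ∘ Equiv.swap 0 i)
  rw [hswap] at h
  refine h.trans_eq ?_
  congr 1
  simp only [Function.comp_apply, Equiv.swap_apply_left]
  exact Equiv.prod_comp (Equiv.swap 0 i) (fun b ↦ ((1 + |x b - x i|) ^ 2)⁻¹)

namespace RudnickSarnak

/-! ## Local sums `∑ (1 + |p_c − x|)^{-2}` -/

/-- `∑_{j ∈ t} 1/(j+1)² ≤ 3` for every finite set `t` of naturals (the full series is
`ζ(2) = π²/6 ≤ 16/6 < 3`, `hasSum_zeta_two`, `π ≤ 4`). [folklore] -/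
theorem sum_inv_succ_sq_le_three (t : Finset ℕ) : ∑ j ∈ t, (((j : ℝ) + 1) ^ 2)⁻¹ ≤ 3 := by
  have h1 : ∑ j ∈ t, (((j : ℝ) + 1) ^ 2)⁻¹ =
      ∑ n ∈ t.map ⟨Nat.succ, Nat.succ_injective⟩, 1 / (n : ℝ) ^ 2 := by
    rw [Finset.sum_map]
    simp [Nat.cast_succ]
  rw [h1]
  calc ∑ n ∈ t.map ⟨Nat.succ, Nat.succ_injective⟩, 1 / (n : ℝ) ^ 2 ≤ Real.pi ^ 2 / 6 :=
      sum_le_hasSum _ (fun n _ ↦ by positivity) hasSum_zeta_two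
    _ ≤ 3 := by nlinarith [Real.pi_le_four, Real.pi_pos]

/-- **Shell decomposition.** If every closed window `[y, y + 1]` contains at most `M` of the
points `p_c` (`c ∈ s`), then `∑_{c ∈ s} (1 + |p_c − x|)^{-2} ≤ 6M` for every `x`: the shell
`j ≤ |p_c − x| < j + 1` is covered by two windows and contributes at most `2M (1 + j)^{-2}`, and
`∑_j (1+j)^{-2} ≤ 3`. (Used with `M ≍ log T` for the normalised ordinates of `ζ` up to height
`T`; Rudnick–Sarnak 1996 §3, Titchmarsh Thm. 9.2.) [folklore] -/
theorem sum_inv_one_add_abs_sub_sq_le {ι : Type*} (s : Finset ι) (p : ι → ℝ) {M : ℝ}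
    (hM : ∀ y : ℝ, ((s.filter fun c ↦ y ≤ p c ∧ p c ≤ y + 1).card : ℝ) ≤ M) (x : ℝ) :
    ∑ c ∈ s, ((1 + |p c - x|) ^ 2)⁻¹ ≤ 6 * M := by
  classical
  have hM0 : 0 ≤ M := (Nat.cast_nonneg _).trans (hM x)
  set J : ι → ℕ := fun c ↦ ⌊|p c - x|⌋₊ with hJ
  have hmaps : ∀ c ∈ s, J c ∈ s.image J := fun c hc ↦ Finset.mem_image_of_mem J hc
  rw [← Finset.sum_fiberwise_of_maps_to hmaps]
  -- each shell
  have hshell : ∀ j ∈ s.image J,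
      ∑ c ∈ s with J c = j, ((1 + |p c - x|) ^ 2)⁻¹ ≤ 2 * M * (((j : ℝ) + 1) ^ 2)⁻¹ := by
    intro j _
    have hterm : ∀ c ∈ s.filter (fun c ↦ J c = j),
        ((1 + |p c - x|) ^ 2)⁻¹ ≤ (((j : ℝ) + 1) ^ 2)⁻¹ := by
      intro c hc
      rw [Finset.mem_filter] at hc
      have hjle : (j : ℝ) ≤ |p c - x| := by
        rw [← hc.2]
        exact Nat.floor_le (abs_nonneg _)
      have : (j : ℝ) + 1 ≤ 1 + |p c - x| := by linarith
      gcongr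
    have hcard : ((s.filter fun c ↦ J c = j).card : ℝ) ≤ 2 * M := by
      have hsub : s.filter (fun c ↦ J c = j) ⊆
          s.filter (fun c ↦ x + j ≤ p c ∧ p c ≤ x + j + 1) ∪
            s.filter (fun c ↦ x - j - 1 ≤ p c ∧ p c ≤ x - j - 1 + 1) := by
        intro c hc
        rw [Finset.mem_filter] at hc
        have hjle : (j : ℝ) ≤ |p c - x| := by
          rw [← hc.2]; exact Nat.floor_le (abs_nonneg _)
        have hjlt : |p c - x| < j + 1 := by
          rw [← hc.2]; exact Nat.lt_floor_add_one _
        rw [Finset.mem_union, Finset.mem_filter, Finset.mem_filter]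
        rcases le_or_gt 0 (p c - x) with h0 | h0
        · rw [abs_of_nonneg h0] at hjle hjlt
          exact Or.inl ⟨hc.1, by linarith, by linarith⟩
        · rw [abs_of_neg h0] at hjle hjlt
          exact Or.inr ⟨hc.1, by linarith, by linarith⟩
      calc ((s.filter fun c ↦ J c = j).card : ℝ)
          ≤ ((s.filter (fun c ↦ x + j ≤ p c ∧ p c ≤ x + j + 1) ∪
              s.filter (fun c ↦ x - j - 1 ≤ p c ∧ p c ≤ x - j - 1 + 1)).card : ℝ) := by
            exact_mod_cast Finset.card_le_card hsub
        _ ≤ ((s.filter (fun c ↦ x + j ≤ p c ∧ p c ≤ x + j + 1)).card : ℝ) +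
              ((s.filter (fun c ↦ x - j - 1 ≤ p c ∧ p c ≤ x - j - 1 + 1)).card : ℝ) := by
            exact_mod_cast Finset.card_union_le _ _
        _ ≤ M + M := add_le_add (hM _) (hM _)
        _ = 2 * M := by ring
    calc ∑ c ∈ s with J c = j, ((1 + |p c - x|) ^ 2)⁻¹
        ≤ ∑ c ∈ s with J c = j, (((j : ℝ) + 1) ^ 2)⁻¹ := Finset.sum_le_sum hterm
      _ = ((s.filter fun c ↦ J c = j).card : ℝ) * (((j : ℝ) + 1) ^ 2)⁻¹ := by
          rw [Finset.sum_const, nsmul_eq_mul]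
      _ ≤ 2 * M * (((j : ℝ) + 1) ^ 2)⁻¹ :=
          mul_le_mul_of_nonneg_right hcard (by positivity)
  calc ∑ j ∈ s.image J, ∑ c ∈ s with J c = j, ((1 + |p c - x|) ^ 2)⁻¹
      ≤ ∑ j ∈ s.image J, 2 * M * (((j : ℝ) + 1) ^ 2)⁻¹ := Finset.sum_le_sum hshell
    _ = 2 * M * ∑ j ∈ s.image J, (((j : ℝ) + 1) ^ 2)⁻¹ := by rw [Finset.mul_sum]
    _ ≤ 2 * M * 3 :=
        mul_le_mul_of_nonneg_left (sum_inv_succ_sq_le_three _) (by positivity)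
    _ = 6 * M := by ring

/-! ## Correlation sums as sums over injective tuples of naturals -/

/-- `levelCorrelationSum n f N = ∑_{j : Fin n ↪ Fin N} f(γ̃ ∘ j)` rewritten as a sum over the
injective tuples `u : Fin n → ℕ` with all values `< N` (the bijection `j ↦ (↑) ∘ j`).
(Rudnick–Sarnak 1996, (1.3)/(3.1): sums over distinct indices.) [cite: RudnickSarnak1996, (1.3)] -/
theorem levelCorrelationSum_eq_sum_filter (n : ℕ) (f : (Fin n → ℝ) → ℂ) (N : ℕ) :
    levelCorrelationSum n f N =
      ∑ u ∈ (Fintype.piFinset fun _ : Fin n ↦ Finset.range N) with Function.Injective u,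
        f (fun a ↦ normalizedOrdinate (u a)) := by
  classical
  unfold levelCorrelationSum
  refine Finset.sum_bij (fun j _ ↦ fun a ↦ ((j a : Fin N) : ℕ)) ?_ ?_ ?_ ?_
  · intro j _
    simp only [Finset.mem_filter, Fintype.mem_piFinset, Finset.mem_range]
    exact ⟨fun a ↦ (j a).isLt, fun a b hab ↦ j.injective (Fin.ext hab)⟩
  · intro j₁ _ j₂ _ h
    ext a
    exact congrFun h a
  · intro u hu
    simp only [Finset.mem_filter, Fintype.mem_piFinset, Finset.mem_range] at hu
    refine ⟨⟨fun a ↦ ⟨u a, hu.1 a⟩, fun a b hab ↦ hu.2 (congrArg Fin.val hab)⟩,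
      Finset.mem_univ _, ?_⟩
    funext a
    rfl
  · intro j _
    rfl

/-- Monotonicity of the index sets: injective tuples with values `< N` are injective tuples with
values `< N'` for `N ≤ N'`. [folklore] -/
theorem filter_piFinset_range_mono {n N N' : ℕ} (h : N ≤ N') :
    ((Fintype.piFinset fun _ : Fin n ↦ Finset.range N).filter fun u ↦ Function.Injective u) ⊆
      (Fintype.piFinset fun _ : Fin n ↦ Finset.range N').filter fun u ↦ Function.Injective u := by
  intro u hu
  simp only [Finset.mem_filter, Fintype.mem_piFinset, Finset.mem_range] at hu ⊢
  exact ⟨fun a ↦ (hu.1 a).trans_le h, hu.2⟩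

/-! ## Tuple sums with one pinned or one large coordinate -/

/-- Tuples `u : Fin n → ℕ` with values in `r` and the coordinate `a` pinned to `b ∈ r`:
`∑_u ∏_{a'} φ(u_{a'}, b) = ∏_{a'} ∑_{c ∈ t_{a'}} φ(c, b)` with `t_a = {b}`, `t_{a'} = r`
otherwise; hence `≤ sⁿ` when `φ ≥ 0`, `φ(b, b) ≤ 1 ≤ s` and `∑_{c ∈ r} φ(c, b) ≤ s`. [folklore] -/
theorem sum_piFinset_filter_eq_prod_le {n : ℕ} (r : Finset ℕ) (a : Fin n) {b : ℕ} (hb : b ∈ r)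
    (φ : ℕ → ℕ → ℝ) (hφ0 : ∀ c d, 0 ≤ φ c d) {s : ℝ} (hs1 : 1 ≤ s) (hφ1 : φ b b ≤ 1)
    (hsum : ∑ c ∈ r, φ c b ≤ s) :
    ∑ u ∈ (Fintype.piFinset fun _ : Fin n ↦ r) with u a = b, ∏ a', φ (u a') b ≤ s ^ n := by
  classical
  have hset : ((Fintype.piFinset fun _ : Fin n ↦ r).filter fun u ↦ u a = b) =
      Fintype.piFinset (fun a' ↦ if a' = a then ({b} : Finset ℕ) else r) := by
    ext u
    simp only [Finset.mem_filter, Fintype.mem_piFinset]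
    constructor
    · rintro ⟨hu, hua⟩ a'
      split_ifs with h
      · subst h
        simp [hua]
      · exact hu a'
    · intro hu
      have hua : u a = b := by simpa using hu a
      refine ⟨fun a' ↦ ?_, hua⟩
      by_cases h : a' = a
      · subst h
        rw [hua]
        exact hb
      · simpa [h] using hu a'
  rw [hset, ← Finset.prod_univ_sum (fun a' ↦ if a' = a then ({b} : Finset ℕ) else r)
    (fun _ c ↦ φ c b)]
  calc ∏ a', ∑ c ∈ (if a' = a then ({b} : Finset ℕ) else r), φ c b ≤ ∏ _a' : Fin n, s := by
        refine Finset.prod_le_prod (fun a' _ ↦ Finset.sum_nonneg fun c _ ↦ hφ0 c b) ?_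
        intro a' _
        split_ifs
        · simpa using hφ1.trans hs1
        · exact hsum
    _ = s ^ n := Fin.prod_const n s

/-- Tuples with values `< N'` whose coordinate `a` is `≥ N`: under the pivot bound
`‖F x‖ ≤ C ∏_{a'} (1 + |x_{a'} − x_i|)^{-2}` (all pivots `i`) and the local bound
`∑_{c < N'} (1 + |p_c − p_b|)^{-2} ≤ s` (`s ≥ 1`, all `b < N'`),
`∑_u ‖F(p ∘ u)‖ ≤ C (N' − N) sⁿ` (pin `u_a = b`, `N ≤ b < N'`, and use the pivot `a`). [folklore] -/
theorem sum_norm_filter_le {n : ℕ} (F : (Fin n → ℝ) → ℂ) (p : ℕ → ℝ) {C s : ℝ} (hC : 0 ≤ C)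
    (hs : 1 ≤ s) (hF : ∀ (x : Fin n → ℝ) (i : Fin n), ‖F x‖ ≤ C * ∏ a, ((1 + |x a - x i|) ^ 2)⁻¹)
    {N N' : ℕ} (hNN' : N ≤ N')
    (hloc : ∀ b < N', ∑ c ∈ Finset.range N', ((1 + |p c - p b|) ^ 2)⁻¹ ≤ s) (a : Fin n) :
    ∑ u ∈ (Fintype.piFinset fun _ : Fin n ↦ Finset.range N') with N ≤ u a,
        ‖F (fun a' ↦ p (u a'))‖ ≤ C * ((N' : ℝ) - N) * s ^ n := by
  classical
  set P := Fintype.piFinset fun _ : Fin n ↦ Finset.range N' with hP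
  have hmaps : ∀ u ∈ P.filter (fun u ↦ N ≤ u a), u a ∈ Finset.Ico N N' := by
    intro u hu
    rw [Finset.mem_filter] at hu
    exact Finset.mem_Ico.2 ⟨hu.2, Finset.mem_range.1 (Fintype.mem_piFinset.1 hu.1 a)⟩
  rw [← Finset.sum_fiberwise_of_maps_to hmaps]
  have hfib : ∀ b ∈ Finset.Ico N N',
      ∑ u ∈ P.filter (fun u ↦ N ≤ u a) with u a = b, ‖F (fun a' ↦ p (u a'))‖ ≤ C * s ^ n := by
    intro b hb
    obtain ⟨-, hbN'⟩ := Finset.mem_Ico.1 hb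
    calc ∑ u ∈ P.filter (fun u ↦ N ≤ u a) with u a = b, ‖F (fun a' ↦ p (u a'))‖
        ≤ ∑ u ∈ P with u a = b, ‖F (fun a' ↦ p (u a'))‖ := by
          apply Finset.sum_le_sum_of_subset_of_nonneg
          · intro u hu
            simp only [Finset.mem_filter] at hu ⊢
            exact ⟨hu.1.1, hu.2⟩
          · intro u _ _
            exact norm_nonneg _
      _ ≤ ∑ u ∈ P with u a = b, C * ∏ a', ((1 + |p (u a') - p b|) ^ 2)⁻¹ := by
          apply Finset.sum_le_sum
          intro u hu
          have hua : u a = b := (Finset.mem_filter.1 hu).2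
          simpa [hua] using hF (fun a' ↦ p (u a')) a
      _ = C * ∑ u ∈ P with u a = b, ∏ a', ((1 + |p (u a') - p b|) ^ 2)⁻¹ := by
          rw [Finset.mul_sum]
      _ ≤ C * s ^ n := by
          refine mul_le_mul_of_nonneg_left ?_ hC
          refine sum_piFinset_filter_eq_prod_le (Finset.range N') a (Finset.mem_range.2 hbN')
            (fun c d ↦ ((1 + |p c - p d|) ^ 2)⁻¹) (fun c d ↦ by positivity) hs (by simp)
            (hloc b hbN')
  calc ∑ b ∈ Finset.Ico N N', ∑ u ∈ P.filter (fun u ↦ N ≤ u a) with u a = b,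
        ‖F (fun a' ↦ p (u a'))‖
      ≤ ∑ b ∈ Finset.Ico N N', C * s ^ n := Finset.sum_le_sum hfib
    _ = C * ((N' : ℝ) - N) * s ^ n := by
        rw [Finset.sum_const, Nat.card_Ico, nsmul_eq_mul, Nat.cast_sub hNN']
        ring

/-- **Difference of correlation sums.** With `S(N) := ∑_{u injective, values < N} F(p ∘ u)`
(cf. `levelCorrelationSum_eq_sum_filter`), the pivot bound for `F` and the local bound `s ≥ 1`
for `p` on indices `< N'`: `‖S(N') − S(N)‖ ≤ n · C (N' − N) sⁿ` for `N ≤ N'` — a tuple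
counted in `S(N')` but not in `S(N)` has some coordinate `≥ N`. [folklore] -/
theorem norm_tupleSum_sdiff_le {n : ℕ} (F : (Fin n → ℝ) → ℂ) (p : ℕ → ℝ) {C s : ℝ} (hC : 0 ≤ C)
    (hs : 1 ≤ s) (hF : ∀ (x : Fin n → ℝ) (i : Fin n), ‖F x‖ ≤ C * ∏ a, ((1 + |x a - x i|) ^ 2)⁻¹)
    {N N' : ℕ} (hNN' : N ≤ N')
    (hloc : ∀ b < N', ∑ c ∈ Finset.range N', ((1 + |p c - p b|) ^ 2)⁻¹ ≤ s) :
    ‖(∑ u ∈ (Fintype.piFinset fun _ : Fin n ↦ Finset.range N') with Function.Injective u,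
          F (fun a ↦ p (u a))) -
        ∑ u ∈ (Fintype.piFinset fun _ : Fin n ↦ Finset.range N) with Function.Injective u,
          F (fun a ↦ p (u a))‖ ≤ n * (C * ((N' : ℝ) - N) * s ^ n) := by
  classical
  set U' := (Fintype.piFinset fun _ : Fin n ↦ Finset.range N').filter
    fun u ↦ Function.Injective u with hU'
  set U := (Fintype.piFinset fun _ : Fin n ↦ Finset.range N).filter
    fun u ↦ Function.Injective u with hU
  have hsub : U ⊆ U' := filter_piFinset_range_mono hNN'
  rw [← Finset.sum_sdiff_eq_sub hsub]
  have hex : ∀ u ∈ U' \ U, ∃ a, N ≤ u a := by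
    intro u hu
    simp only [hU', hU, Finset.mem_sdiff, Finset.mem_filter, Fintype.mem_piFinset,
      Finset.mem_range, not_and] at hu
    by_contra h
    push Not at h
    exact hu.2 (fun a ↦ h a) hu.1.2
  calc ‖∑ u ∈ U' \ U, F (fun a ↦ p (u a))‖
      ≤ ∑ u ∈ U' \ U, ‖F (fun a ↦ p (u a))‖ := norm_sum_le _ _
    _ ≤ ∑ u ∈ U' \ U, ∑ a : Fin n, if N ≤ u a then ‖F (fun a' ↦ p (u a'))‖ else 0 := by
        refine Finset.sum_le_sum fun u hu ↦ ?_
        obtain ⟨a, ha⟩ := hex u hu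
        calc ‖F (fun a ↦ p (u a))‖ = if N ≤ u a then ‖F (fun a' ↦ p (u a'))‖ else 0 := by
              rw [if_pos ha]
          _ ≤ ∑ a : Fin n, if N ≤ u a then ‖F (fun a' ↦ p (u a'))‖ else 0 :=
              Finset.single_le_sum (f := fun a ↦ if N ≤ u a then ‖F (fun a' ↦ p (u a'))‖ else 0)
                (fun a _ ↦ by split_ifs <;> positivity) (Finset.mem_univ a)
    _ = ∑ a : Fin n, ∑ u ∈ U' \ U, if N ≤ u a then ‖F (fun a' ↦ p (u a'))‖ else 0 :=
        Finset.sum_comm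
    _ ≤ ∑ _a : Fin n, C * ((N' : ℝ) - N) * s ^ n := by
        refine Finset.sum_le_sum fun a _ ↦ ?_
        rw [← Finset.sum_filter]
        calc ∑ u ∈ (U' \ U) with N ≤ u a, ‖F (fun a' ↦ p (u a'))‖
            ≤ ∑ u ∈ (Fintype.piFinset fun _ : Fin n ↦ Finset.range N') with N ≤ u a,
                ‖F (fun a' ↦ p (u a'))‖ := by
              apply Finset.sum_le_sum_of_subset_of_nonneg
              · intro u hu
                simp only [hU', Finset.mem_filter, Finset.mem_sdiff] at hu ⊢
                exact ⟨hu.1.1.1, hu.2⟩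
              · intro u _ _
                exact norm_nonneg _
          _ ≤ C * ((N' : ℝ) - N) * s ^ n := sum_norm_filter_le F p hC hs hF hNN' hloc a
    _ = n * (C * ((N' : ℝ) - N) * s ^ n) := by
        rw [Finset.sum_const, Finset.card_univ, Fintype.card_fin, nsmul_eq_mul]

/-- **Size of a correlation sum.** Under the same hypotheses (with `N' = N`) and `n ≥ 1`
(witnessed by a coordinate `a : Fin n`): `‖S(N)‖ ≤ C N sⁿ`. [folklore] -/
theorem norm_tupleSum_le {n : ℕ} (F : (Fin n → ℝ) → ℂ) (p : ℕ → ℝ) {C s : ℝ} (hC : 0 ≤ C)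
    (hs : 1 ≤ s) (hF : ∀ (x : Fin n → ℝ) (i : Fin n), ‖F x‖ ≤ C * ∏ a, ((1 + |x a - x i|) ^ 2)⁻¹)
    {N : ℕ} (hloc : ∀ b < N, ∑ c ∈ Finset.range N, ((1 + |p c - p b|) ^ 2)⁻¹ ≤ s) (a : Fin n) :
    ‖∑ u ∈ (Fintype.piFinset fun _ : Fin n ↦ Finset.range N) with Function.Injective u,
        F (fun a ↦ p (u a))‖ ≤ C * N * s ^ n := by
  classical
  calc ‖∑ u ∈ (Fintype.piFinset fun _ : Fin n ↦ Finset.range N) with Function.Injective u,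
          F (fun a ↦ p (u a))‖
      ≤ ∑ u ∈ (Fintype.piFinset fun _ : Fin n ↦ Finset.range N) with Function.Injective u,
          ‖F (fun a ↦ p (u a))‖ := norm_sum_le _ _
    _ ≤ ∑ u ∈ (Fintype.piFinset fun _ : Fin n ↦ Finset.range N) with 0 ≤ u a,
          ‖F (fun a ↦ p (u a))‖ := by
        apply Finset.sum_le_sum_of_subset_of_nonneg
        · intro u hu
          simp only [Finset.mem_filter] at hu ⊢
          exact ⟨hu.1, Nat.zero_le _⟩
        · intro u _ _
          exact norm_nonneg _
    _ ≤ C * ((N : ℝ) - (0 : ℕ)) * s ^ n := sum_norm_filter_le F p hC hs hF (Nat.zero_le N) hloc a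
    _ = C * N * s ^ n := by simp

end RudnickSarnak

end Literature.NumberTheory.LFunctions

end
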